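import Mathlib
import HarnessLib
import Summits.KontsevichZagierPeriods.Zeta5Search.VWPBarnesKernelUniform
import Literature.Analysis.Complex.MellinBarnesShift

/-!
# ζ(5) search — shifting the Barnes contour of `F_m` past the poles `0, 1, …, N` of `Γ(−s)` (cell `pub-zeta5`, ct-1 g28)

HONEST FRAMING: systematic search; no irrationality claim unless kernel-certified.  A contour-shift identity for a Mellin–Barnes
integral (special functions); nothing here is an irrationality result, a worthiness exponent or a denominator statement; no named
fact is discharged; no definition is introduced.

Third piece of brick B4 of `HOME/ct-1/g27/VWP-BLUEPRINT-g27.md` (Barnes-integral representation of Zudilin's very-well-poised series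
`F_m`, math/0206177 (1); Nesterenko 2003, Lemma 3).  With the kernel
`V(s) = (h₀ + 2s) ∏_{j≤m} Γ(h_j + s) Γ(−s) / ∏_{j<m} Γ(1 + h₀ − h_{j+1} + s)` of `VWPBarnesKernel`, a phase `e^{iεπs}` (`|ε| ≤ 1`) and a
weight `w^s` (`w > 0`), the residue theorem for the vertical strip `−s₁ ≤ Re s ≤ N + ½`
(`Literature.Analysis.Complex.integral_vertical_sub_eq_sum_of_simplePoles`, PROVED) gives

  `∫ (V e^{iεπs} w^s)(N+½+iy) dy − ∫ (V e^{iεπs} w^s)(−s₁+iy) dy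
      = −2π Σ_{n≤N} [(h₀+2n)∏_{j≤m}Γ(h_j+n)/∏_{j<m}Γ(1+h₀−h_{j+1}+n)/n!] (−1)^n e^{iεπn} w^n`      (`integral_far_sub_integral_base`)

under `0 < s₁ < Re h_j`, `s₁ < Re(1+h₀−h_{j+1})` and Zudilin's (5) (which makes both lines absolutely convergent with the phase).
The residues of `Γ(−s)` at `s = n` are `−(−1)^n/n!` (`MellinBarnesShift.Gamma_eq_div_div`); the horizontal cross-sections are
`O(|T|^{E})`, `E < −1`, by `VWPBarnesKernelUniform.norm_vwpKernel_le_uniform`.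

* `norm_phase_le`, `norm_weight_eq`, `continuous_integrand_line`, `integrable_integrand_line` — the integrand on pole-free lines;
* **`integral_far_sub_integral_base`** — the shift.

Theorems only; imports `Zeta5Search/VWPBarnesKernelUniform`, `Literature.Analysis.Complex.MellinBarnesShift` (proved).
-/

noncomputable section

namespace Summit.KontsevichZagierPeriods.Zeta5Search.VWPBarnesShift

open MeasureTheory Set Filter
open scoped Real Topology
open Literature.Analysis.Complex (integral_vertical_sub_eq_sum_of_simplePoles Gamma_eq_div_div
  differentiableOn_Gamma_add_div_prod Gamma_add_div_prod_neg_nat)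
open Summit.KontsevichZagierPeriods.Zeta5Search.VWPBarnesKernelUniform

variable {m : ℕ} {h : ℕ → ℂ} {s₁ ε w : ℝ}

/-! ### 1. The integrand `V(s) e^{iεπs} w^s` on a pole-free line -/

/-- `‖e^{iεπs}‖ = e^{−επ Im s} ≤ e^{π|Im s|}` for `|ε| ≤ 1`. -/
theorem norm_phase_le (hε : |ε| ≤ 1) (s : ℂ) : ‖Complex.exp (ε * π * Complex.I * s)‖ ≤ Real.exp (π * |s.im|) := by
  rw [Complex.norm_exp]
  apply Real.exp_le_exp.2
  have hre : ((ε : ℂ) * π * Complex.I * s).re = -(ε * π * s.im) := by simp [Complex.mul_re, Complex.mul_im]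
  rw [hre]
  have h1 : -(ε * π * s.im) ≤ |ε * π * s.im| := neg_le_abs _
  rw [abs_mul, abs_mul, abs_of_pos Real.pi_pos] at h1
  have h2 : |ε| * π * |s.im| ≤ 1 * π * |s.im| := by gcongr
  linarith

/-- `‖w^s‖ = w^{Re s}` for `w > 0`. -/
theorem norm_weight_eq (hw : 0 < w) (s : ℂ) : ‖(w : ℂ) ^ s‖ = w ^ s.re :=
  Complex.norm_cpow_eq_rpow_re_of_pos hw s

/-- Continuity of `y ↦ (V e^{iεπs} w^s)(x + iy)` on a pole-free line `Re s = x`. -/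
theorem continuous_integrand_line (m : ℕ) (h : ℕ → ℂ) (ε : ℝ) (hw : 0 < w) {x : ℝ} (hx : ∀ n : ℕ, x ≠ n)
    (hnum : ∀ j, j ≤ m → -(h j).re < x) (hden : ∀ j, j < m → -(1 + h 0 - h (j + 1)).re < x) :
    Continuous fun y : ℝ =>
      (h 0 + 2 * ((x : ℂ) + (y : ℂ) * Complex.I)) *
              (∏ j ∈ Finset.range (m + 1), Complex.Gamma (h j + ((x : ℂ) + (y : ℂ) * Complex.I))) *
              Complex.Gamma (-((x : ℂ) + (y : ℂ) * Complex.I)) /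
            (∏ j ∈ Finset.range m, Complex.Gamma (1 + h 0 - h (j + 1) + ((x : ℂ) + (y : ℂ) * Complex.I))) *
          Complex.exp (ε * π * Complex.I * ((x : ℂ) + (y : ℂ) * Complex.I)) *
        (w : ℂ) ^ ((x : ℂ) + (y : ℂ) * Complex.I) := by
  have hw0 : (w : ℂ) ≠ 0 := by exact_mod_cast hw.ne'
  refine ((continuous_vwpKernel_line m h hx hnum hden).mul (by fun_prop)).mul ?_
  exact Continuous.const_cpow (by fun_prop) (Or.inl hw0)

/-- **Integrability on a pole-free line under (5)**: `y ↦ (V e^{iεπs} w^s)(x + iy)` is integrable (majorant `‖V‖e^{π|y|}·w^x`). -/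
theorem integrable_integrand_line (m : ℕ) (h : ℕ → ℂ) (hε : |ε| ≤ 1) (hw : 0 < w) {x : ℝ} (hx : ∀ n : ℕ, x ≠ n)
    (hnum : ∀ j, j ≤ m → -(h j).re < x) (hden : ∀ j, j < m → -(1 + h 0 - h (j + 1)).re < x)
    (h5 : 2 * (∑ j ∈ Finset.range m, (h (j + 1)).re) < ((m : ℝ) - 1) * (1 + (h 0).re)) :
    Integrable fun y : ℝ =>
      (h 0 + 2 * ((x : ℂ) + (y : ℂ) * Complex.I)) *
              (∏ j ∈ Finset.range (m + 1), Complex.Gamma (h j + ((x : ℂ) + (y : ℂ) * Complex.I))) *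
              Complex.Gamma (-((x : ℂ) + (y : ℂ) * Complex.I)) /
            (∏ j ∈ Finset.range m, Complex.Gamma (1 + h 0 - h (j + 1) + ((x : ℂ) + (y : ℂ) * Complex.I))) *
          Complex.exp (ε * π * Complex.I * ((x : ℂ) + (y : ℂ) * Complex.I)) *
        (w : ℂ) ^ ((x : ℂ) + (y : ℂ) * Complex.I) := by
  have hmaj := (integrable_norm_vwpKernel_line_mul_exp_pi m h hx hnum hden h5).mul_const (w ^ x)
  refine hmaj.mono' (continuous_integrand_line m h ε hw hx hnum hden).aestronglyMeasurable
    (Eventually.of_forall fun y => ?_)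
  rw [norm_mul, norm_mul, norm_weight_eq hw]
  simp only [Complex.add_re, Complex.ofReal_re, Complex.mul_re, Complex.I_re, mul_zero, Complex.ofReal_im,
    Complex.I_im, mul_one, sub_self, add_zero]
  have hph := norm_phase_le hε ((x : ℂ) + (y : ℂ) * Complex.I)
  simp only [Complex.add_im, Complex.ofReal_im, Complex.mul_im, Complex.I_re, Complex.I_im, Complex.ofReal_re,
    mul_zero, mul_one, zero_add, add_zero] at hph
  have hwx : 0 ≤ w ^ x := (Real.rpow_pos_of_pos hw x).le
  gcongr

/-! ### 2. The shift past the poles `0, 1, …, N` -/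

/-- **Shifting the Barnes contour of `F_m` from `Re s = −s₁` to `Re s = N + ½`.**  For `h : ℕ → ℂ`, `0 < s₁ < Re h_j` (`j ≤ m`),
`s₁ < Re(1 + h₀ − h_{j+1})` (`j < m`), Zudilin's (5) `2 Σ_{j=1}^m Re h_j < (m−1)(1 + Re h₀)`, a phase `|ε| ≤ 1`, a weight `w > 0`
and `N : ℕ`: with `F(s) = V(s) e^{iεπs} w^s`,

`∫ F(N+½+iy) dy − ∫ F(−s₁+iy) dy = −2π Σ_{n ≤ N} [(h₀+2n) ∏_{j≤m}Γ(h_j+n) / ∏_{j<m}Γ(1+h₀−h_{j+1}+n) / n!] · (−1)^n e^{iεπn} w^n`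

— the residues of `Γ(−s)` at `s = n` are `−(−1)^n/n!` [Nesterenko 2003, proof of Lemma 3; Zudilin math/0206177, §2]. -/
theorem integral_far_sub_integral_base (m : ℕ) (h : ℕ → ℂ) (hs₁ : 0 < s₁) (hnum : ∀ j, j ≤ m → s₁ < (h j).re)
    (hden : ∀ j, j < m → s₁ < (1 + h 0 - h (j + 1)).re)
    (h5 : 2 * (∑ j ∈ Finset.range m, (h (j + 1)).re) < ((m : ℝ) - 1) * (1 + (h 0).re))
    (hε : |ε| ≤ 1) (hw : 0 < w) (N : ℕ) :
    (∫ y : ℝ,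
        (h 0 + 2 * ((((N : ℝ) + 1 / 2 : ℝ) : ℂ) + (y : ℂ) * Complex.I)) *
                (∏ j ∈ Finset.range (m + 1), Complex.Gamma (h j + ((((N : ℝ) + 1 / 2 : ℝ) : ℂ) + (y : ℂ) * Complex.I))) *
                Complex.Gamma (-((((N : ℝ) + 1 / 2 : ℝ) : ℂ) + (y : ℂ) * Complex.I)) /
              (∏ j ∈ Finset.range m,
                Complex.Gamma (1 + h 0 - h (j + 1) + ((((N : ℝ) + 1 / 2 : ℝ) : ℂ) + (y : ℂ) * Complex.I))) *
            Complex.exp (ε * π * Complex.I * ((((N : ℝ) + 1 / 2 : ℝ) : ℂ) + (y : ℂ) * Complex.I)) *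
          (w : ℂ) ^ ((((N : ℝ) + 1 / 2 : ℝ) : ℂ) + (y : ℂ) * Complex.I)) -
      ∫ y : ℝ,
        (h 0 + 2 * (-(s₁ : ℂ) + (y : ℂ) * Complex.I)) *
                (∏ j ∈ Finset.range (m + 1), Complex.Gamma (h j + (-(s₁ : ℂ) + (y : ℂ) * Complex.I))) *
                Complex.Gamma (-(-(s₁ : ℂ) + (y : ℂ) * Complex.I)) /
              (∏ j ∈ Finset.range m, Complex.Gamma (1 + h 0 - h (j + 1) + (-(s₁ : ℂ) + (y : ℂ) * Complex.I))) *
            Complex.exp (ε * π * Complex.I * (-(s₁ : ℂ) + (y : ℂ) * Complex.I)) *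
          (w : ℂ) ^ (-(s₁ : ℂ) + (y : ℂ) * Complex.I) =
      -(2 * π * ∑ n ∈ Finset.range (N + 1),
        ((h 0 + 2 * (n : ℂ)) * (∏ j ∈ Finset.range (m + 1), Complex.Gamma (h j + n)) /
              (∏ j ∈ Finset.range m, Complex.Gamma (1 + h 0 - h (j + 1) + n)) / (n.factorial : ℂ)) *
            (-1 : ℂ) ^ n * Complex.exp (ε * π * Complex.I * n) * (w : ℂ) ^ n) := by
  classical
  set a : ℝ := -s₁ with ha_def
  set b : ℝ := (N : ℝ) + 1 / 2 with hb_def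
  have hab : a < b := by rw [ha_def, hb_def]; linarith [N.cast_nonneg (α := ℝ)]
  have hw0 : (w : ℂ) ≠ 0 := by exact_mod_cast hw.ne'
  have haline : ((a : ℝ) : ℂ) = -(s₁ : ℂ) := by rw [ha_def]; push_cast; ring
  -- the kernel and the full integrand
  set V : ℂ → ℂ := fun s => (h 0 + 2 * s) * (∏ j ∈ Finset.range (m + 1), Complex.Gamma (h j + s)) *
      Complex.Gamma (-s) / ∏ j ∈ Finset.range m, Complex.Gamma (1 + h 0 - h (j + 1) + s) with hV_def
  set F : ℂ → ℂ := fun s => V s * Complex.exp (ε * π * Complex.I * s) * (w : ℂ) ^ s with hF_def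
  -- the regular part of `Γ(−s)` at `s = n` and the residue function
  set G : ℕ → ℂ → ℂ := fun n z =>
    Complex.Gamma (-z + ((n + 1 : ℕ) : ℂ)) / ∏ i ∈ Finset.range n, (-z + (i : ℂ)) with hG_def
  set φ : ℕ → ℂ → ℂ := fun n z => -((h 0 + 2 * z) * (∏ j ∈ Finset.range (m + 1), Complex.Gamma (h j + z)) * G n z /
      (∏ j ∈ Finset.range m, Complex.Gamma (1 + h 0 - h (j + 1) + z)) *
        Complex.exp (ε * π * Complex.I * z) * (w : ℂ) ^ z) with hφ_def
  set r : ℂ → ℂ := fun p => φ ⌊p.re⌋₊ p with hr_def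
  -- poles, the open set
  set S : Finset ℂ := (Finset.range (N + 1)).image fun n : ℕ => (n : ℂ) with hS_def
  set Uh : Set ℂ := ⋂ j ∈ Finset.range (m + 1), {z : ℂ | -(h j).re < z.re} with hUh_def
  set U : Set ℂ := {z : ℂ | z.re < (N : ℝ) + 1} ∩ Uh with hU_def
  have hUh_open : IsOpen Uh := isOpen_biInter_finset fun j _ => isOpen_lt continuous_const Complex.continuous_re
  have hU : IsOpen U := (isOpen_lt Complex.continuous_re continuous_const).inter hUh_open
  have hmemUh : ∀ {z : ℂ}, z ∈ Uh ↔ ∀ j, j ≤ m → -(h j).re < z.re := by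
    intro z
    simp only [hUh_def, Set.mem_iInter, Set.mem_setOf_eq, Finset.mem_range, Nat.lt_succ_iff]
  have hmemS : ∀ {p : ℂ}, p ∈ S ↔ ∃ n : ℕ, n ≤ N ∧ p = (n : ℂ) := by
    intro p
    simp only [hS_def, Finset.mem_image, Finset.mem_range, Nat.lt_succ_iff]
    constructor
    · rintro ⟨n, hn, rfl⟩; exact ⟨n, hn, rfl⟩
    · rintro ⟨n, hn, rfl⟩; exact ⟨n, hn, rfl⟩
  have hKU : Complex.re ⁻¹' Icc a b ⊆ U := by
    intro z hz
    simp only [Set.mem_preimage, Set.mem_Icc, ha_def, hb_def] at hz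
    refine ⟨by simp only [Set.mem_setOf_eq]; linarith [hz.2], hmemUh.2 fun j hj => ?_⟩
    linarith [hnum j hj, hz.1]
  have hS : ∀ p ∈ S, p.re ∈ Ioo a b := by
    intro p hp
    obtain ⟨n, hn, rfl⟩ := hmemS.1 hp
    have : (n : ℝ) ≤ N := by exact_mod_cast hn
    simp only [Complex.natCast_re, Set.mem_Ioo, ha_def, hb_def]
    constructor <;> linarith [n.cast_nonneg (α := ℝ)]
  -- off `S`, points of `U` are not natural numbers
  have hnotnat : ∀ z ∈ U \ ↑S, ∀ n : ℕ, z ≠ n := by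
    intro z hz n hzn
    apply hz.2
    have hlt : z.re < (N : ℝ) + 1 := hz.1.1
    rw [hzn, Complex.natCast_re] at hlt
    have : (n : ℝ) < ((N + 1 : ℕ) : ℝ) := by push_cast; exact hlt
    have hnN : n ≤ N := by have := Nat.cast_lt.mp this; omega
    rw [hzn]; exact_mod_cast hmemS.2 ⟨n, hnN, rfl⟩
  -- holomorphy of `F` on `U ∖ S`
  have hF : DifferentiableOn ℂ F (U \ ↑S) := by
    intro z hz
    refine DifferentiableAt.differentiableWithinAt ?_
    have hV := differentiableAt_vwpKernel m h (z := z) (hmemUh.1 hz.1.2) (hnotnat z hz)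
    exact (hV.mul (by fun_prop)).mul (differentiableAt_id.const_cpow (Or.inl hw0))
  -- the simple poles
  have hpole : ∀ p ∈ S, ∃ ψ : ℂ → ℂ, ∃ W ∈ 𝓝 p, DifferentiableOn ℂ ψ W ∧ ψ p = r p ∧
      ∀ z ∈ W, z ≠ p → F z = ψ z / (z - p) := by
    intro p hp
    obtain ⟨n, hn, rfl⟩ := hmemS.1 hp
    have hnUh : (n : ℂ) ∈ Uh := hmemUh.2 fun j hj => by
      simp only [Complex.natCast_re]; linarith [hnum j hj, n.cast_nonneg (α := ℝ)]
    refine ⟨φ n, Metric.ball (n : ℂ) (1 / 2) ∩ Uh,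
      Filter.inter_mem (Metric.ball_mem_nhds _ (by norm_num)) (hUh_open.mem_nhds hnUh), ?_, ?_, ?_⟩
    · -- differentiability of the regular part
      have hG : DifferentiableOn ℂ (G n) (Metric.ball (n : ℂ) (1 / 2)) := by
        have hcomp := (differentiableOn_Gamma_add_div_prod n).comp (differentiable_neg.differentiableOn)
          (s := Metric.ball (n : ℂ) (1 / 2)) (fun z hz => by
            simp only [Metric.mem_ball, dist_eq_norm] at hz ⊢
            rw [show -z - -(n : ℂ) = -(z - n) by ring, norm_neg]; exact hz)
        refine hcomp.congr fun z _ => ?_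
        simp only [hG_def, Function.comp]
      intro z hz
      have hzUh := hmemUh.1 hz.2
      have hznat : ∀ j, j ≤ m → ∀ k : ℕ, h j + z ≠ -(k : ℂ) := fun j hj k =>
        BarnesMellin.ne_neg_nat_of_re_pos (by simp; linarith [hzUh j hj]) k
      have h1 : DifferentiableAt ℂ (fun z => (h 0 + 2 * z) * (∏ j ∈ Finset.range (m + 1), Complex.Gamma (h j + z))) z := by
        refine DifferentiableAt.mul (by fun_prop) ?_
        refine DifferentiableAt.fun_finsetProd (f := fun j s => Complex.Gamma (h j + s)) fun j hj => ?_
        exact (Complex.differentiableAt_Gamma _ (hznat j (by simpa [Nat.lt_succ_iff] using hj))).comp z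
          ((differentiableAt_const _).add differentiableAt_id)
      have h2 : DifferentiableWithinAt ℂ (G n) (Metric.ball (n : ℂ) (1 / 2) ∩ Uh) z :=
        (hG z hz.1).mono Set.inter_subset_left
      have h3 : DifferentiableAt ℂ (fun z => (∏ j ∈ Finset.range m, Complex.Gamma (1 + h 0 - h (j + 1) + z))⁻¹) z := by
        have hrew : (fun z : ℂ => (∏ j ∈ Finset.range m, Complex.Gamma (1 + h 0 - h (j + 1) + z))⁻¹) =
            fun z => ∏ j ∈ Finset.range m, (Complex.Gamma (1 + h 0 - h (j + 1) + z))⁻¹ := by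
          funext z; rw [Finset.prod_inv_distrib]
        rw [hrew]
        refine DifferentiableAt.fun_finsetProd (f := fun j s => (Complex.Gamma (1 + h 0 - h (j + 1) + s))⁻¹)
          fun j _ => ?_
        exact (Complex.differentiable_one_div_Gamma.differentiableAt).comp z
          ((differentiableAt_const _).add differentiableAt_id)
      have h4 : DifferentiableAt ℂ (fun z => Complex.exp (ε * π * Complex.I * z) * (w : ℂ) ^ z) z :=
        DifferentiableAt.mul (by fun_prop) (differentiableAt_id.const_cpow (Or.inl hw0))
      have hall := ((h1.differentiableWithinAt.mul h2).mul h3.differentiableWithinAt).mul h4.differentiableWithinAt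
      refine (hall.neg).congr (fun y _ => ?_) ?_
      · simp only [hφ_def, Pi.neg_apply, Pi.mul_apply, div_eq_mul_inv]; ring
      · simp only [hφ_def, Pi.neg_apply, Pi.mul_apply, div_eq_mul_inv]; ring
    · -- the value at the pole
      have hfl : ⌊((n : ℂ)).re⌋₊ = n := by simp
      simp only [hr_def, hfl]
    · -- `F = φ/(z − n)` near `n`
      intro z _ hzn
      simp only [hF_def, hV_def, hφ_def, hG_def]
      rw [Gamma_eq_div_div n (-z), show (-z + (n : ℂ)) = -(z - n) by ring, div_neg]
      ring
  -- integrability on the two lines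
  have hbnat : ∀ n : ℕ, b ≠ n := fun n hbn => by
    rw [hb_def] at hbn
    have h2 : (2 * N + 1 : ℝ) = ((2 * n : ℕ) : ℝ) := by push_cast; linarith
    have := (Nat.cast_inj (R := ℝ)).mp (by push_cast; linarith : ((2 * N + 1 : ℕ) : ℝ) = ((2 * n : ℕ) : ℝ))
    omega
  have hanat : ∀ n : ℕ, a ≠ n := fun n han => by
    rw [ha_def] at han; linarith [n.cast_nonneg (α := ℝ)]
  have hinta : Integrable fun y : ℝ => F (a + y * Complex.I) := by
    have := integrable_integrand_line m h hε hw hanat (fun j hj => by rw [ha_def]; linarith [hnum j hj])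
      (fun j hj => by rw [ha_def]; linarith [hden j hj]) h5
    simpa only [hF_def, hV_def] using this
  have hintb : Integrable fun y : ℝ => F (b + y * Complex.I) := by
    have := integrable_integrand_line m h hε hw hbnat
      (fun j hj => by rw [hb_def]; linarith [hnum j hj, N.cast_nonneg (α := ℝ)])
      (fun j hj => by rw [hb_def]; linarith [hden j hj, N.cast_nonneg (α := ℝ)]) h5
    simpa only [hF_def, hV_def] using this
  -- decay on the horizontal cross-sections
  have hdecay : ∀ δ : ℝ, 0 < δ → ∃ T₀ : ℝ, ∀ T : ℝ, T₀ ≤ |T| → ∀ x ∈ Icc a b, ‖F (x + T * Complex.I)‖ ≤ δ := by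
    intro δ hδ
    obtain ⟨C, hC, R, hR, hb⟩ := norm_vwpKernel_le_uniform m h a b
    set E : ℝ := 2 * (∑ j ∈ Finset.range m, (h (j + 1)).re) - ((m : ℝ) - 1) * (h 0).re - m with hE
    have hE1 : E ≤ -1 := by rw [hE]; linarith
    set W : ℝ := max (w ^ a) (w ^ b) with hW
    have hW0 : 0 < W := lt_max_of_lt_left (Real.rpow_pos_of_pos hw _)
    have hwx : ∀ x ∈ Icc a b, w ^ x ≤ W := by
      intro x hx
      rcases le_or_gt 1 w with h1 | h1
      · exact (Real.rpow_le_rpow_of_exponent_le h1 hx.2).trans (le_max_right _ _)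
      · exact (Real.rpow_le_rpow_of_exponent_ge hw h1.le hx.1).trans (le_max_left _ _)
    refine ⟨max R (C * W / δ), fun T hT x hx => ?_⟩
    have hTR : R ≤ |T| := le_trans (le_max_left _ _) hT
    have hT1 : 1 ≤ |T| := le_trans hR hTR
    have hT0 : 0 < |T| := by linarith
    have hTδ : C * W / δ ≤ |T| := le_trans (le_max_right _ _) hT
    set s : ℂ := (x : ℂ) + (T : ℂ) * Complex.I with hs
    have hsre : s.re = x := by simp [hs]
    have hsim : s.im = T := by simp [hs]
    have hVb : ‖V s‖ ≤ C * |T| ^ E * Real.exp (-(π * |T|)) := by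
      have := hb s (by rw [hsre]; exact hx) (by rw [hsim]; exact hTR)
      simpa only [hV_def, hsim] using this
    have hpow : |T| ^ E ≤ |T| ^ (-1 : ℝ) := Real.rpow_le_rpow_of_exponent_le hT1 hE1
    have hinv : |T| ^ (-1 : ℝ) = |T|⁻¹ := Real.rpow_neg_one |T|
    have hph : ‖Complex.exp (ε * π * Complex.I * s)‖ ≤ Real.exp (π * |T|) := by
      have := norm_phase_le hε s; rwa [hsim] at this
    have hws : ‖(w : ℂ) ^ s‖ ≤ W := by rw [norm_weight_eq hw, hsre]; exact hwx x hx
    calc ‖F s‖ = ‖V s‖ * ‖Complex.exp (ε * π * Complex.I * s)‖ * ‖(w : ℂ) ^ s‖ := by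
          simp only [hF_def, norm_mul]
      _ ≤ (C * |T| ^ E * Real.exp (-(π * |T|))) * Real.exp (π * |T|) * W := by gcongr
      _ = C * W * |T| ^ E := by
          rw [show C * |T| ^ E * Real.exp (-(π * |T|)) * Real.exp (π * |T|) * W =
            C * W * |T| ^ E * (Real.exp (-(π * |T|)) * Real.exp (π * |T|)) by ring, ← Real.exp_add]
          simp
      _ ≤ C * W * |T|⁻¹ := by rw [← hinv]; gcongr
      _ ≤ δ := by
          rw [div_le_iff₀ hδ] at hTδ
          rw [mul_inv_le_iff₀ hT0]
          linarith
  -- the residue theorem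
  have hres := integral_vertical_sub_eq_sum_of_simplePoles hab S r U hU hKU hS hF hpole hinta hintb hdecay
  -- the residues
  have hsum : ∑ p ∈ S, r p = -∑ n ∈ Finset.range (N + 1),
      ((h 0 + 2 * (n : ℂ)) * (∏ j ∈ Finset.range (m + 1), Complex.Gamma (h j + n)) /
            (∏ j ∈ Finset.range m, Complex.Gamma (1 + h 0 - h (j + 1) + n)) / (n.factorial : ℂ)) *
          (-1 : ℂ) ^ n * Complex.exp (ε * π * Complex.I * n) * (w : ℂ) ^ n := by
    rw [hS_def, Finset.sum_image (fun n₁ _ n₂ _ hn => by exact_mod_cast hn), ← Finset.sum_neg_distrib]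
    refine Finset.sum_congr rfl fun n _ => ?_
    have hfl : ⌊((n : ℂ)).re⌋₊ = n := by simp
    simp only [hr_def, hfl, hφ_def, hG_def]
    rw [Gamma_add_div_prod_neg_nat n, Complex.cpow_natCast]
    have hn : (n.factorial : ℂ) ≠ 0 := by exact_mod_cast n.factorial_ne_zero
    field_simp
  rw [hsum] at hres
  simp only [hF_def, hV_def, haline] at hres
  rw [mul_neg] at hres
  exact hres

end Summit.KontsevichZagierPeriods.Zeta5Search.VWPBarnesShift

end
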